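import Summits.QuantumFields.BalabanUV.T4Continuum.Support.NE9CurChartOneInstanceSmallBondsGaugeOrbit
import Literature.MathematicalPhysics.QuantumFieldTheory.Balaban1983to89.B9Thm311SmallPlaquettes

/-!
# NE9CurChartOneInstanceSmallPlaquettes — THE ONE-INSTANCE CHART OF `cur U` ON ONE PAIR OF BALLS AT EVERY UNIT-BOUNDED UNITARY BACKGROUND `U` OF A
# FIXED LATTICE WHOSE PLAQUETTE VARIABLES AND CLOSED COORDINATE LINES ARE CLOSE TO `1` — print's regularity class [Balaban1987RG1] (1.11)–(1.12) ∕
# [Balaban1985BackgroundPropagators] (3.35) on the one-cube torus, the small gauge CONSTRUCTED (this lineage's torus axial gauge `B7Eq44TorusAxialGauge`),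
# NOT given: this seat's (G10) `Support/NE9CurChartOneInstanceSmallBondsGaugeOrbit` AT `U` ITSELF via `U = V^{g′}`, `V := U^g` small-bond; cell
# `pub-balaban`, T4-DAG §2 node U3 ∕ §6 NE9, route R2′; Summits-side NEW leaf under this seat's INTERFACE REQUEST NE9 (ruling e34b3e0c (0) — requested:
# `NE9CurChartOneInstanceSmallPlaquettes.cur_chart_exists_oneInstance_smallJ_of_small_plaquettes_unitary`), nothing printed asserted

HONEST FRAMING (T4-DAG PAGE 1).  Rung (B)+1 of the FINITE-VOLUME T⁴ programme — NOT infinite volume, NOT a mass gap, NOT the Clay problem.  NE9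
(`T4OutputRate.NE9` ∧ `FadingMemory`) is a cell NEW ESTIMATE, NOT PRINTED in [I] = [Balaban1987RG1] (CMP **109**), [II] = [Balaban1988RG2Cluster]
(CMP **116**), and NOT PROVED here («NE9 ⇐ the named binders»; spine PROVED 0∕9).  HONEST DEPENDENCY (cell line, verbatim): continuum YM on T⁴ ⇐
BetaPertH ∧ nine spine estimates (0/9 proved); BetaPertH ⇐ (D1) ∧ (D4) ∧ CAP+tail; G-an2-4 gates asym, D1 and NE2/3/4.  The `cur U` OBJECT is ONE
item of the MODEL O-NE9-1 (species (a) data); the END's `act` ∕ `ker` halves and NEEDS-COORDINATOR #5 are untouched.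

THE PRINT (loci only).  [Balaban1987RG1] p. 262 (1.10)–(1.12): *«The space U^c_j(X, α₀, α₁, γ₀) is a union of orbits [(U, J)] … (i) U = U′U, U has
values in the group G, |∂U − 1| < α₀ξ² on X, (1.11) for each cube □ ⊂ X of a size O(1)LM there exists a G-valued gauge transformation u defined on □
and such, that U^u = exp iξA, |A|, |∇^ξA| < O(1)LMBα₀ on □, (1.12)»*; [Balaban1985BackgroundPropagators] p. 396 (3.35) *«there exists a gauge
transformation u on □ such that U^u = e^{iηA}, |A| < …»*, (3.34) *«Δ_a(U^u) = R(u)Δ_a(U)R(u⁻¹), G(U^u) = R(u)G(U)R(u⁻¹)»*; [Balaban1985Averaging] p. 24,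
the axial gauge `v₀(x) = v₀(y)V(Γ_{y,x})` and (45) `|V₀(∂p) − 1| = |V(∂p) − 1|`.  On a TORUS «all plaquette variables small ⇒ some gauge makes all bond
variables small» is FALSE without the closed coordinate lines (`B7Eq45TorusGaugeOrbit.not_small_bond_orbit_slice`); with them it holds
(`B7Eq44TorusAxialGauge.norm_gaugeU_axialGaugeT_sub_one_le`).

WHAT THIS FILE PROVES (ONE theorem; 0 def, 0 sorry, axioms standard).  **`cur_chart_exists_oneInstance_smallJ_of_small_plaquettes_unitary`**: (G10)'s
`∃ ε₃ ≤ ε_reg(d, L)`, `a_C ε_C a₃ C₄ ε₄ R_b R′`, `0 < j₁ ≤ M_J` (THE SAME numbers) such that for EVERY background `U` of the fixed lattice `T_{L·m}` with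
`U(b) ∈ U1`, `U(b)* = U(b)⁻¹`, ALL plaquette variables `‖U(∂p) − 1‖ ≤ δ`, ALL closed coordinate lines `‖U(C_{x,μ}) − 1‖ ≤ θ` (`L·m_i ≤ N`), and a
radius `ε` with `d(N−1)²δ + θ ≤ ε ≤ ε₃`, `ε ≤ ε_reg(d, L)`, the V₀-slot read AT `U` and all currents `‖J‖ ≤ j₁`, `‖Δπ‖ ≤ M_Δ` AT `U`: `hpos′(U)` HOLDS
and `QuadAnalytic (W80 …) C₄ a₃ ∧ ‖𝔊(U) ∘L L_J‖ ≤ ½ ∧ (Ψ1)–(Ψ3)` for the one-instance chart of `cur U` on `ball 0 R_b → ball 0 R′` — AT `U` IN ITS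
GIVEN GAUGE, E162's structural slots of `U` PRODUCED (`alpha_le_64`, `perCfg_mem_U1`, `B9Thm311SmallPlaquettes.hreg_of_small_plaquettes`,
`alphaL_le_half`).  MECHANISM: `B7Eq45TorusGaugeOrbit.exists_small_bond_gauge_unitary` writes `U = V^{g′}` with `V` unit-bounded unitary
`ε`-small-bond and `g′` unit-bounded unitary; `obtain ⟨V, g′, …, rfl⟩`; (G10) `cur_chart_exists_oneInstance_gaugeOrbit_smallJ_of_small_bonds_unitary`
at `(V, g′)` IS the goal, the structural proof slots agreeing by proof irrelevance.
DISGUISE TEST: composition of landed theorems; no inequality of the series proved; per-LATTICE numbers (the admissible `δ, θ` shrink like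
`(d(N−1)²)⁻¹` with the period) — NOT print's uniformity in the lattice, NOT print's per-cube O(1)LM, NOT p. 416's per-cube locality reduction; not NE9.
References (TYPES ∕ loci only): [Balaban1985Variational] (45)–(47) p. 285, Prop. 6 (117)–(121) p. 295, (172)–(175) p. 305;
[Balaban1985BackgroundPropagators] (3.28)–(3.35) pp. 395–396, Thm 3.11 p. 416; [Balaban1985Averaging] (44)–(45) p. 24; [Balaban1987RG1] (1.10)–(1.12) p. 262.
Imports `Support/NE9CurChartOneInstanceSmallBondsGaugeOrbit` (this lineage, (G10)) and `B9Thm311SmallPlaquettes` (this lineage, (A2b)) ONLY; modifies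
nothing; no END re-wired.  Value = route R2′ bookkeeping at rung (B)+1 (the species' chart on print's gauge-invariant regularity class of the one-cube
torus), NOT summit progress.
-/

noncomputable section

open Metric Set
open scoped InnerProductSpace

namespace Summit.QuantumFields.BalabanUV.T4Continuum.NE9CurChartOneInstanceSmallPlaquettes

open Literature.MathematicalPhysics.QuantumFieldTheory.Balaban1983to89
open B11Eq103H1Complex B11Eq115Space B11Eq174Chart
open B11Eq111FrakG (nabla115)
open B13Contraction113 (QuadAnalytic)
open B9Eq319QprimeTorus (fineP)
open B9SectCLatticeCarrier (Bond)
open B4Sect5Torus (TSite)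
open B7Prop1Explicit (U1)
open B9Eq315QTorus (laplaceAofBackground)
open B9Eq315QTorusOnto (QtorusW_surjective)
open B9Eq310DeltaPrime (plaqHolU)
open B9Eq335SmallBondsData (perCfg_mem_U1 alpha_le_64 alphaL_le_half)
open B11Eq44COperatorTorus (Cc)
open B11Eq80Current (W80)
open B11Eq79LinearTerm (LJ)
open B11Eq63V0GroupCurrent (curV0)
open B7Eq44TorusAxialGauge (lineHolT)
open B7Eq45TorusGaugeOrbit (exists_small_bond_gauge_unitary)
open B9Thm311SmallPlaquettes (hreg_of_small_plaquettes)
open Summit.QuantumFields.BalabanUV.T4Continuum.NE9CurChartOneInstanceSmallBondsGaugeOrbit (cur_chart_exists_oneInstance_gaugeOrbit_smallJ_of_small_bonds_unitary)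

set_option maxRecDepth 8192 in
/-- **THE ONE-INSTANCE CHART OF `cur U` ON ONE PAIR OF BALLS AT EVERY UNIT-BOUNDED UNITARY BACKGROUND WITH SMALL PLAQUETTE VARIABLES AND SMALL CLOSED
COORDINATE LINES, ALL SMALL CURRENTS** — (G10) `cur_chart_exists_oneInstance_gaugeOrbit_smallJ_of_small_bonds_unitary` AT `U` ITSELF: background binders
{`U(b) ∈ U1`, `U(b)* = U(b)⁻¹`, `‖U(∂p) − 1‖ ≤ δ` (all plaquettes), `‖U(C_{x,μ}) − 1‖ ≤ θ` (all closed lines), `L·m_i ≤ N`, `d(N−1)²δ + θ ≤ ε ≤ ε₃`,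
`ε ≤ ε_reg(d, L)`} — GAUGE-INVARIANT data and a radius, NO gauge given; E162's structural slots of `U` PRODUCED (`perCfg_mem_U1`, `hreg_of_small_plaquettes`);
the same `∃`-numbers as (G10); conclusion = `∃ hpos′ ∧ QuadAnalytic ∧ ‖𝔊(U) ∘L L_J‖ ≤ ½ ∧ (Ψ1)–(Ψ3)` at `∇_U`.  `U = V^{g′}` by
`B7Eq45TorusGaugeOrbit.exists_small_bond_gauge_unitary` (the torus axial gauge), then (G10) at `(V, g′)` verbatim.  Print's (1.12) ∕ (3.35) shape on
the one-cube torus; the closed-line binder is the torus's price (no-go `B7Eq45TorusGaugeOrbit.not_small_bond_orbit_slice`). [folklore] -/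
theorem cur_chart_exists_oneInstance_smallJ_of_small_plaquettes_unitary {d : ℕ} (L : ℕ) [NeZero L] (m : Fin d → ℕ) [∀ i, NeZero (fineP L m i)]
    (hL : 1 ≤ L)
    {𝔸 : Type*} [NormedRing 𝔸] [NormedAlgebra ℂ 𝔸] [CompleteSpace 𝔸] [NormOneClass 𝔸] [StarRing 𝔸] [NormedStarGroup 𝔸] [StarModule ℂ 𝔸]
    [FiniteDimensional ℂ 𝔸]
    {W : Type*} [NormedAddCommGroup W] [InnerProductSpace ℂ W] [FiniteDimensional ℂ W] (φ : W ≃ₗ[ℂ] 𝔸) {Mφ Mφ' : ℝ} (hMφ : 0 ≤ Mφ)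
    (hMφ' : 0 ≤ Mφ') (hφ : ∀ w, ‖φ w‖ ≤ Mφ * ‖w‖) (hφ' : ∀ X, ‖φ.symm X‖ ≤ Mφ' * ‖X‖)
    (τ : 𝔸 →ₗ[ℂ] ℂ) {Cτ : ℝ} (hτ : ∀ X, ‖τ X‖ ≤ Cτ * ‖X‖) (hCτ : 0 ≤ Cτ)
    (hτφ : ∀ X Y : 𝔸, inner ℂ (φ.symm X) (φ.symm Y) = τ (star X * Y)) (htr : ∀ X Y : 𝔸, τ (X * Y) = τ (Y * X))
    {η : ℝ} [Fact (0 < (L : ℝ))] [Fact (0 < η)] {lev₀ : Bond d (fineP L m) → ℕ} {levB : Bond d m → ℕ} (lev₁ : Bond d (fineP L m) × Fin d → ℕ)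
    (hlev : ∀ b, 1 ≤ lev₀ b) {c₀ c₁ : ℝ} [Fact (0 < c₀)] [Fact (0 < c₁)] {a : ℝ} (ha : 0 < a)
    (ρ : (𝔸 →L[ℂ] ℂ) →L[ℂ] 𝔸) (τc : 𝔸 →L[ℂ] ℂ) {CV RV MJ MΔ : ℝ} (hCV : 0 ≤ CV) (hRV : 0 < RV) (hMJ : 0 < MJ) (hMΔ : 0 ≤ MΔ) :
    ∃ ε₃ aC εC a₃ C₄ ε₄ Rb R' j₁ : ℝ, 0 < ε₃ ∧ ε₃ ≤ 1 / (256 * ((d : ℝ) + 1) ^ 2 * (L : ℝ) ^ (d + 1)) ∧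
      0 < aC ∧ 0 < εC ∧ 0 < a₃ ∧ 0 ≤ C₄ ∧ 0 < ε₄ ∧ 0 < Rb ∧ 0 < R' ∧ 0 < j₁ ∧ j₁ ≤ MJ ∧
      ∀ (U : Bond d (fineP L m) → 𝔸ˣ) (hU : ∀ b, U b ∈ U1 𝔸), (∀ b, star (U b : 𝔸) = (((U b)⁻¹ : 𝔸ˣ) : 𝔸)) →
      ∀ {N : ℕ} (hN : ∀ i, fineP L m i ≤ N) {δ : ℝ} (hδ0 : 0 ≤ δ) (hδ : ∀ p : B9SectCLatticeCarrier.Plaq d (fineP L m), ‖(plaqHolU U p : 𝔸) - 1‖ ≤ δ)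
        {θ : ℝ} (hθ0 : 0 ≤ θ) (hθ : ∀ (x : TSite d (fineP L m)) (μ : Fin d), ‖((lineHolT (fineP L m) U x μ : 𝔸ˣ) : 𝔸) - 1‖ ≤ θ)
        {ε : ℝ} (hε : 0 ≤ ε) (hεb : (d : ℝ) * ((N : ℝ) - 1) ^ 2 * δ + θ ≤ ε)
        (hεr : ε ≤ 1 / (256 * ((d : ℝ) + 1) ^ 2 * (L : ℝ) ^ (d + 1))), ε ≤ ε₃ →
        (∀ Y : Space115 (L : ℝ) η lev₀ lev₁ (nabla115 η U), ‖Y‖ < RV →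
          ‖curV0 (lev₁ := lev₁) (Dc := nabla115 η U) ρ τc U Y‖ ≤ CV * ‖Y‖ ^ 2) →
      ∀ (J : NegSize (L : ℝ) η lev₀ 3 𝔸) (Δπ : Space115 (L : ℝ) η lev₀ lev₁ (nabla115 η U) →L[ℂ] NegSize (L : ℝ) η lev₀ 3 𝔸),
        ‖J‖ ≤ j₁ → ‖Δπ‖ ≤ MΔ →
      ∃ hpos : ∀ x : BondL2K ℂ d (fineP L m) c₀ W, x ≠ 0 →
          0 < RCLike.re (inner ℂ x (laplaceAofBackground L m hL φ U (alpha_le_64 hL hε hεr) (perCfg_mem_U1 L m hU)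
            (hreg_of_small_plaquettes L m hU hN hδ0 hδ hθ0 hθ hε hεb) τ η (c₀ := c₀) (c₁ := c₁) a x)),
      let Hc := H1LatticeCLM (lev₀ := lev₀) (levB := levB) φ hpos (QtorusW_surjective L m hL U (alpha_le_64 hL hε hεr)
        (perCfg_mem_U1 L m hU) (hreg_of_small_plaquettes L m hU hN hδ0 hδ hθ0 hθ hε hεb) (alphaL_le_half hL hεr) φ) lev₁ (nabla115 η U)
      let Gc := frakGLatticeCLM (lev₀ := lev₀) φ hpos (QtorusW_surjective L m hL U (alpha_le_64 hL hε hεr)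
        (perCfg_mem_U1 L m hU) (hreg_of_small_plaquettes L m hU hN hδ0 hδ hθ0 hθ hε hεb) (alphaL_le_half hL hεr) φ) lev₁ (nabla115 η U)
      let Cx := Cc L m η U lev₀ lev₁ (nabla115 η U) levB
      QuadAnalytic (W80 ρ τc U Hc Cx εC J Δπ) C₄ a₃ ∧ ‖Gc.comp (LJ ρ τc Hc Cx J)‖ ≤ 1 / 2 ∧
      DifferentiableOn ℂ (chartHB Gc (-(Gc.comp (LJ ρ τc Hc Cx J))) (W80 ρ τc U Hc Cx εC J Δπ) 0
          (fun A' => A' + solA Hc 0 Cx 0 εC A') ε₄ Hc) (ball (0 : NegSize (L : ℝ) η levB 0 𝔸) Rb) ∧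
      MapsTo (chartHB Gc (-(Gc.comp (LJ ρ τc Hc Cx J))) (W80 ρ τc U Hc Cx εC J Δπ) 0
          (fun A' => A' + solA Hc 0 Cx 0 εC A') ε₄ Hc) (ball (0 : NegSize (L : ℝ) η levB 0 𝔸) Rb)
          (ball (0 : Space115 (L : ℝ) η lev₀ lev₁ (nabla115 η U)) R') ∧
      chartHB Gc (-(Gc.comp (LJ ρ τc Hc Cx J))) (W80 ρ τc U Hc Cx εC J Δπ) 0
          (fun A' => A' + solA Hc 0 Cx 0 εC A') ε₄ Hc 0 = 0 := by
  obtain ⟨ε₃, aC, εC, a₃, C₄, ε₄, Rb, R', j₁, hε₃, hle, haC, hεC, ha₃, hC₄, hε₄, hRb, hR', hj₁, hj₁M, H⟩ :=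
    cur_chart_exists_oneInstance_gaugeOrbit_smallJ_of_small_bonds_unitary L m hL φ hMφ hMφ' hφ hφ' τ hτ hCτ hτφ htr (η := η) (lev₀ := lev₀)
      (levB := levB) lev₁ hlev (c₀ := c₀) (c₁ := c₁) ha ρ τc hCV hRV hMJ hMΔ
  refine ⟨ε₃, aC, εC, a₃, C₄, ε₄, Rb, R', j₁, hε₃, hle, haC, hεC, ha₃, hC₄, hε₄, hRb, hR', hj₁, hj₁M, ?_⟩
  intro U hU hUstar N hN δ hδ0 hδ θ hθ0 hθ ε hε hεb hεr hεm hqV J Δπ hJ hΔ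
  obtain ⟨V, g', hV, hVstar, hVε, hg', hg'star, rfl⟩ := exists_small_bond_gauge_unitary (fineP L m) hU hN hδ0 hδ hθ0 hθ hUstar
  exact H V hV hε hεr hεm (fun b => (hVε b).trans hεb) hVstar hg' hg'star hqV J Δπ hJ hΔ

end Summit.QuantumFields.BalabanUV.T4Continuum.NE9CurChartOneInstanceSmallPlaquettes

end
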